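import Mathlib
import Summits.NavierStokesRegularity.OSWSelfSimilar.TypeIIInnerLimitTypeBetaKillForms
import HarnessLib
/-!
# The inner object of an axisymmetric singularity: constant axial stream OR (AX-L) counterexample — UNCONDITIONAL
# (zone Z1 TEMPLATE §T1.4-I (I-2)–(I-5) assembled on K8's standing hypotheses WITHOUT the conjecture; kernel)

HONEST FRAMING (cell ns-blowup GROUP B «PROFILE SEARCH», zone Z1; D-0035/D-0074): part XXV of the Z1 dictionary. Parts
XXII/XXIII assembled TEMPLATE §T1.4-I as «IF (AX-L) holds, the inner object is constant». This file removes the conjecture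
from the HYPOTHESES and puts it where the TEMPLATE has it — in the type-(β) branch of the CONCLUSION: on K8's standing
hypotheses verbatim (maximal smooth solution with finite lifespan, Leray–Hopf, bounded on closed sub-slabs, axisymmetric,
bounded initial swirl) a gauge N-a zoom converges along a subsequence to a KNSS blow-up limit `W` which is

  EITHER (α) constant in space on every slice,
  OR     (β) axisymmetric with swirl `≤ ‖Γ₀‖_∞` on every slice and NON-constant on some slice — and then (part XXIV, all by
         DISCHARGED tree theorems) it REFUTES `AxisymmetricLiouvilleBoundedSwirl`, carries swirl, has `r‖W_pol‖` unbounded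
         (`violates: V-CR`), `Γ_W ∉ L^∞_s L^p` for every finite `p ≥ 1`, and `Γ_W` non-decaying at radial infinity.

* `innerLimit_caseA_data_standing` — Case A (`rₖ/λₖ → d`) from the standing hypotheses, NO conjecture: the axis-centred zoom
  converges along a subsequence to a KNSS blow-up limit with AXISYMMETRIC slices and swirl `≤ Mₛ` (the proof of part XXII's
  `innerLimit_const_caseA_standing_under_axisymmetricLiouville` with its last step — the appeal to (AX-L) — replaced by part
  XVIII's `caseA_data_of_axisCentred_zoom` / part XII's `abs_swirl_ancientLimit_le_of_lifespan`);
* `innerLimit_dichotomy_of_unbounded`, `innerLimit_dichotomy_of_singularity` — the Case-A/Case-B split assembled without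
  (AX-L): constant (Case B, part XXI) ∨ axisymmetric with swirl `≤ Mₛ` (Case A);
* `innerLimit_alternative_of_singularity` — **THE CENSUS SENTENCE BY DECL, UNCONDITIONAL**: (α) ∨ [(β) ∧ ¬(AX-L) ∧ the
  (I-5) kill forms (i)–(iv)]. Under (AX-L) the second branch is contradictory, so this statement contains part XXIII's
  `innerLimit_const_of_singularity_under_axisymmetricLiouville` (not restated: same type, gate dedup).

**Nothing here asserts that such a singular solution exists, that (AX-L) holds or fails, or anything about Navier–Stokes
regularity/blow-up; every statement is an implication on a hypothetical singular solution.** «violates: n/a — dictionary»;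
bears_on LADDER-NS N5/Z1 → N1 linear core / N0⁻ ((I-2)/(I-3)/(I-4)/(I-5)). Author: ns-blowup-profile-eng-1 g8, 2026-08-27.
-/

open Real Filter Topology Set MeasureTheory Function Bornology
open scoped ENNReal NNReal
open Literature.Analysis.FluidPDE

namespace Summit.NavierStokesRegularity.OSWSelfSimilar
namespace TypeIIModulationDictionary

section Alternative

variable {T Mₛ : ℝ} {u : ℝ → EuclideanSpace ℝ (Fin 3) → EuclideanSpace ℝ (Fin 3)}
  {p : ℝ → EuclideanSpace ℝ (Fin 3) → ℝ}

/-- **TEMPLATE (I-3), CASE A FROM THE STANDING HYPOTHESES — NO CONJECTURE: the axis-centred inner object is axisymmetric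
with swirl `≤ ‖Γ₀‖_∞`.** Let `u` be classical (`ν = 1`, unforced) on `[0, T⋆) × ℝ³` with axisymmetric slices, bounded with
bounded energy on closed sub-slabs, with bounded initial swirl `|x_h| |u_θ(0)| ≤ Mₛ`; let `tₖ ∈ [t₁, T⋆)` (`t₁ > 0`),
`λₖ > 0`, `λₖ → 0`, with meridional near-max points `rₖ e₀ + zₖ e₂`, `λₖ‖u‖ ≤ 1` on `[0, tₖ]`,
`λₖ‖u(tₖ, rₖ e₀ + zₖ e₂)‖ → 1`, and CASE A: `rₖ/λₖ → d`. Then the AXIS-CENTRED zoom `y ↦ λₖ u(tₖ + λₖ² s, zₖ e₂ + λₖ y)`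
converges along a subsequence, slice-wise locally uniformly, to a KNSS blow-up limit `W` whose slices `W(s, ·)`, `s < 0`,
are AXISYMMETRIC with `|Γ_W(s, y)| ≤ Mₛ`. (Part XXII's proof with (AX-L) removed: KNSS Prop 6.1 near-vertex form + parts
XII/XVIII/XX.) [new here — dictionary] -/
theorem innerLimit_caseA_data_standing (hT : 0 < T) (hu : IsClassicalNSSolutionOn (Ico 0 T) 1 0 u p)
    (haxi : ∀ t, IsAxisymmetric (u t))
    (hE : ∀ S < T, ∃ C : ℝ≥0∞, C < ⊤ ∧ ∀ t ∈ Icc 0 S, ∫⁻ x, ‖u t x‖ₑ ^ 2 ≤ C)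
    (hbdd : ∀ S < T, ∃ N : ℝ, 0 < N ∧ ∀ t ∈ Icc 0 S, ∀ x, ‖u t x‖ ≤ N) (hMₛ : ∀ x, |swirl (u 0) x| ≤ Mₛ)
    {tn lamn rn zn : ℕ → ℝ} {t₁ : ℝ} (ht₁ : 0 < t₁) (htn : ∀ k, t₁ ≤ tn k ∧ tn k < T)
    (hlam : ∀ k, 0 < lamn k) (hlam0 : Tendsto lamn atTop (𝓝 0))
    (hgauge : ∀ k, ∀ t ∈ Icc 0 (tn k), ∀ x, lamn k * ‖u t x‖ ≤ 1)
    (hnear : Tendsto (fun k => lamn k *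
      ‖u (tn k) (EuclideanSpace.single 0 (rn k) + EuclideanSpace.single 2 (zn k))‖) atTop (𝓝 1))
    {d : ℝ} (hcaseA : Tendsto (fun k => rn k / lamn k) atTop (𝓝 d)) :
    ∃ (φ : ℕ → ℕ) (W : ℝ → EuclideanSpace ℝ (Fin 3) → EuclideanSpace ℝ (Fin 3)), StrictMono φ ∧
      IsKNSSBlowupLimit W ∧
      (∀ s < 0, TendstoLocallyUniformly
        (fun k => (lamn (φ k) • stPull (lamn (φ k) ^ 2) (lamn (φ k)) (tn (φ k))
          (EuclideanSpace.single 2 (zn (φ k))) u) s) (W s) atTop) ∧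
      (∀ s < 0, IsAxisymmetric (W s)) ∧ ∀ s < 0, ∀ y : EuclideanSpace ℝ (Fin 3), |swirl (W s) y| ≤ Mₛ := by
  -- as in part XXII `innerLimit_const_caseA_standing_under_axisymmetricLiouville`, minus the conjecture
  set xc : ℕ → EuclideanSpace ℝ (Fin 3) := fun k => EuclideanSpace.single 2 (zn k) with hxc
  set A : ℕ → ℝ := fun k => -tn k / lamn k ^ 2 with hA
  set B : ℕ → ℝ := fun k => (T - tn k) / lamn k ^ 2 with hB
  set w : ℕ → ℝ → EuclideanSpace ℝ (Fin 3) → EuclideanSpace ℝ (Fin 3) :=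
    fun k => lamn k • stPull (lamn k ^ 2) (lamn k) (tn k) (xc k) u with hw_def
  have hBpos : ∀ k, 0 < B k := fun k => div_pos (sub_pos.2 (htn k).2) (pow_pos (hlam k) 2)
  have hAlim : Tendsto A atTop atBot := by
    have hl2 : Tendsto (fun k => lamn k ^ 2) atTop (𝓝[>] 0) := by
      refine tendsto_nhdsWithin_iff.2 ⟨by simpa using hlam0.pow 2, Eventually.of_forall fun k => ?_⟩
      exact pow_pos (hlam k) 2
    have hinv : Tendsto (fun k => (lamn k ^ 2)⁻¹) atTop atTop := tendsto_inv_nhdsGT_zero.comp hl2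
    have hmaj : Tendsto (fun k => -t₁ * (lamn k ^ 2)⁻¹) atTop atBot :=
      hinv.const_mul_atTop_of_neg (by linarith)
    refine tendsto_atBot_mono (fun k => ?_) hmaj
    have hl2k : 0 < lamn k ^ 2 := pow_pos (hlam k) 2
    show -tn k / lamn k ^ 2 ≤ -t₁ * (lamn k ^ 2)⁻¹
    rw [div_eq_mul_inv]
    exact mul_le_mul_of_nonneg_right (by linarith [(htn k).1]) (inv_nonneg.2 hl2k.le)
  have hw : ∀ k, IsClassicalNSSolutionOn (Ioo (A k) (B k)) 1 0 (w k)
      (lamn k ^ 2 • stPull (lamn k ^ 2) (lamn k) (tn k) (xc k) p) :=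
    fun k => zoom_isClassical hu (hlam k) (tn k) (xc k)
  have hmild : ∀ k, ∀ s t : ℝ, A k < s → s < t → t < B k → ∀ x,
      w k t x = Literature.Analysis.UnboundedOperators.heatExtension (w k s) (t - s) x -
        oseenDuhamel 1 s (w k) (w k) t x :=
    fun k s t hs hst ht x => zoom_oseenMild hu hE hbdd (hlam k) (tn k) (xc k) hs hst ht x
  have hbd1 : ∀ k, ∀ τ ∈ Ioc (A k) 0, ∀ x, ‖w k τ x‖ ≤ 1 := by
    intro k τ hτ x
    have hl2k : 0 < lamn k ^ 2 := pow_pos (hlam k) 2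
    have h1 : 0 ≤ tn k + lamn k ^ 2 * τ := by
      have : -tn k / lamn k ^ 2 < τ := hτ.1
      rw [div_lt_iff₀ hl2k] at this; linarith
    have h2 : tn k + lamn k ^ 2 * τ ≤ tn k := by nlinarith [hτ.2]
    have h := hgauge k (tn k + lamn k ^ 2 * τ) ⟨h1, h2⟩ (xc k + lamn k • x)
    simpa [hw_def, stPull_apply, norm_smul, abs_of_pos (hlam k)] using h
  -- the near-max points of the axis-centred zoom: `yₖ = (rₖ/λₖ) e₀ → d e₀`
  set yv : ℕ → EuclideanSpace ℝ (Fin 3) := fun k => (rn k / lamn k) • EuclideanSpace.single 0 (1 : ℝ) with hyv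
  have hy : Tendsto yv atTop (𝓝 (d • EuclideanSpace.single 0 (1 : ℝ))) := hcaseA.smul_const _
  have hpt : ∀ k, xc k + lamn k • yv k = EuclideanSpace.single 0 (rn k) + EuclideanSpace.single 2 (zn k) := by
    intro k
    have hl : lamn k ≠ 0 := (hlam k).ne'
    ext i
    fin_cases i
    · simp [hxc, hyv]; field_simp
    · simp [hxc, hyv]
    · simp [hxc, hyv]
  have hnearpt : Tendsto (fun k => ‖w k 0 (yv k)‖) atTop (𝓝 1) := by
    refine hnear.congr fun k => ?_
    simp only [hw_def, Pi.smul_apply, stPull_apply, norm_smul, Real.norm_eq_abs, abs_of_pos (hlam k),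
      mul_zero, add_zero]
    rw [hpt k]
  obtain ⟨φ, W, hφ, hW, hconv⟩ :=
    isKNSSBlowupLimit_of_oseenMild_zoom_nearVertex hAlim hBpos hw hmild hbd1 hy hnearpt
  refine ⟨φ, W, hφ, hW, hconv, ?_⟩
  -- pointwise convergence of the axis-centred zoom along the subsequence, then parts XII/XVIII (no conjecture)
  have hlim : ∀ s < 0, ∀ y, Tendsto (fun n => lamn (φ n) • u (tn (φ n) + lamn (φ n) ^ 2 * s)
      (xc (φ n) + lamn (φ n) • y)) atTop (𝓝 (W s y)) := by
    intro s hs y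
    have h := ((hconv s hs).tendstoLocallyUniformlyOn (s := univ)).tendsto_at (mem_univ y)
    exact h.congr fun n => by simp [hw_def, stPull_apply]
  have htT : Tendsto tn atTop (𝓝 T) :=
    tendsto_tn_of_zoom_data hbdd (fun k => ⟨ht₁.le.trans (htn k).1, (htn k).2⟩) hlam hlam0 hnear
  have haxi' : ∀ t ∈ Ico 0 T, IsAxisymmetric (u t) := fun t _ => haxi t
  have hbdd' : ∀ T' < T, ∃ V₀ : ℝ, ∀ t ∈ Icc 0 T', ∀ x, ‖u t x‖ ≤ V₀ :=
    fun S hS => (hbdd S hS).imp fun N hN => hN.2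
  have hxc0 : ∀ n, xc (φ n) 0 = 0 ∧ xc (φ n) 1 = 0 := fun n => by simp [hxc]
  refine ⟨fun s hs => isAxisymmetric_ancientLimit_of_axisCentred hT haxi' (htT.comp hφ.tendsto_atTop)
      (fun n => (htn (φ n)).2) (hlam0.comp hφ.tendsto_atTop) hxc0 hs.le (hlim s hs), fun s hs y => ?_⟩
  exact abs_swirl_ancientLimit_le_of_lifespan one_pos hT hu haxi' hbdd' hMₛ (htT.comp hφ.tendsto_atTop)
    (fun n => (htn (φ n)).2) (hlam0.comp hφ.tendsto_atTop) hxc0 hs.le (hlim s hs) y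

/-- **TEMPLATE (I-2)/(I-3) ASSEMBLED WITHOUT THE CONJECTURE: constant (Case B) OR axisymmetric with swirl `≤ ‖Γ₀‖_∞`
(Case A).** Let `u` be classical (`ν = 1`, unforced) on `[0, T⋆) × ℝ³` (`T⋆ > 0`) with axisymmetric slices, bounded with
bounded energy on every closed sub-slab, with bounded initial swirl `≤ Mₛ`, and UNBOUNDED on `[0, T⋆)`. Then there are
gauge N-a zoom data `tₖ ∈ [T⋆/2, T⋆)`, `λₖ → 0`, centres `cₖ` (`λₖ‖u‖ ≤ 1` on `[0, tₖ]`) and a subsequence along which the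
zoom `y ↦ λₖ u(tₖ + λₖ² s, cₖ + λₖ y)` converges slice-wise locally uniformly to a KNSS blow-up limit `W` with
EITHER `W(s, ·) ≡ W(s, 0)` for all `s < 0` (Case B `rₖ/λₖ → ∞`, part XXI — type (α)), OR axisymmetric slices with
`|Γ_W| ≤ Mₛ` (Case A, previous theorem — the (AX-L) class). [new here — dictionary; unconditional] -/
theorem innerLimit_dichotomy_of_unbounded (hT : 0 < T) (hu : IsClassicalNSSolutionOn (Ico 0 T) 1 0 u p)
    (haxi : ∀ t, IsAxisymmetric (u t))
    (hE : ∀ S < T, ∃ C : ℝ≥0∞, C < ⊤ ∧ ∀ t ∈ Icc 0 S, ∫⁻ x, ‖u t x‖ₑ ^ 2 ≤ C)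
    (hbdd : ∀ S < T, ∃ N : ℝ, 0 < N ∧ ∀ t ∈ Icc 0 S, ∀ x, ‖u t x‖ ≤ N) (hMₛ : ∀ x, |swirl (u 0) x| ≤ Mₛ)
    (hunb : ∀ N : ℝ, ∃ t ∈ Ico 0 T, ∃ x : EuclideanSpace ℝ (Fin 3), N < ‖u t x‖) :
    ∃ (tn lamn : ℕ → ℝ) (cn : ℕ → EuclideanSpace ℝ (Fin 3)) (φ : ℕ → ℕ)
      (W : ℝ → EuclideanSpace ℝ (Fin 3) → EuclideanSpace ℝ (Fin 3)),
      (∀ k, T / 2 ≤ tn k ∧ tn k < T) ∧ (∀ k, 0 < lamn k) ∧ Tendsto lamn atTop (𝓝 0) ∧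
      (∀ k, ∀ t ∈ Icc 0 (tn k), ∀ x, lamn k * ‖u t x‖ ≤ 1) ∧ StrictMono φ ∧ IsKNSSBlowupLimit W ∧
      (∀ s < 0, TendstoLocallyUniformly
        (fun k => (lamn (φ k) • stPull (lamn (φ k) ^ 2) (lamn (φ k)) (tn (φ k)) (cn (φ k)) u) s) (W s) atTop) ∧
      ((∀ s < 0, ∀ y : EuclideanSpace ℝ (Fin 3), W s y = W s 0) ∨
        ((∀ s < 0, IsAxisymmetric (W s)) ∧ ∀ s < 0, ∀ y : EuclideanSpace ℝ (Fin 3), |swirl (W s) y| ≤ Mₛ)) := by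
  obtain ⟨tn, lamn, rn, zn, htn, hlam, hlam0, hrn, hgauge, hnear⟩ :=
    exists_meridional_zoom_data_of_unbounded hT haxi hbdd hunb
  have hT2 : 0 < T / 2 := by positivity
  by_cases hbA : BddAbove (Set.range fun k => rn k / lamn k)
  · -- Case A along a subsequence: `rₖ/λₖ → d`
    obtain ⟨C, hC⟩ := hbA
    obtain ⟨d, -, ψ, hψ, hd⟩ := tendsto_subseq_of_bounded (Metric.isBounded_Icc (0 : ℝ) C)
      (x := fun k => rn k / lamn k) fun k => ⟨div_nonneg (hrn k) (hlam k).le, hC ⟨k, rfl⟩⟩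
    obtain ⟨φ, W, hφ, hW, hconv, hax, hsw⟩ :=
      innerLimit_caseA_data_standing hT hu haxi hE hbdd hMₛ
        (tn := tn ∘ ψ) (lamn := lamn ∘ ψ) (rn := rn ∘ ψ) (zn := zn ∘ ψ) hT2 (fun k => htn (ψ k))
        (fun k => hlam (ψ k)) (hlam0.comp hψ.tendsto_atTop) (fun k => hgauge (ψ k))
        (hnear.comp hψ.tendsto_atTop) hd
    exact ⟨tn, lamn, fun k => EuclideanSpace.single 2 (zn k), ψ ∘ φ, W, htn, hlam, hlam0, hgauge,
      hψ.comp hφ, hW, hconv, Or.inr ⟨hax, hsw⟩⟩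
  · -- Case B along a subsequence: `rₖ/λₖ → ∞` (part XXI, unconditional)
    obtain ⟨ψ, hψ, hd⟩ := exists_subseq_tendsto_atTop_of_not_bddAbove hbA
    obtain ⟨φ, W, hφ, hW, hconv, hconst⟩ :=
      innerLimit_const_caseB_standing hu haxi hE hbdd (tn := tn ∘ ψ) (lamn := lamn ∘ ψ) (rn := rn ∘ ψ)
        (zn := zn ∘ ψ) hT2 (fun k => htn (ψ k)) (fun k => hlam (ψ k)) (hlam0.comp hψ.tendsto_atTop)
        (fun k => hgauge (ψ k)) (hnear.comp hψ.tendsto_atTop) hd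
    exact ⟨tn, lamn, fun k => EuclideanSpace.single 0 (rn k) + EuclideanSpace.single 2 (zn k), ψ ∘ φ, W, htn,
      hlam, hlam0, hgauge, hψ.comp hφ, hW, hconv, Or.inl hconst⟩

/-- **The dichotomy on K8's STANDING HYPOTHESES VERBATIM (as part XXIII prints them), without the conjecture**: for a
maximal smooth solution (`ν = 1`, unforced) with finite lifespan `T⋆ > 0`, Leray–Hopf on `[0, T⋆)` from `u 0`, bounded on
every closed sub-slab, with axisymmetric slices and bounded initial swirl `≤ Mₛ`, a gauge N-a zoom converges along a
subsequence to a KNSS blow-up limit `W` which is EITHER constant in space on every slice OR axisymmetric with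
`|Γ_W| ≤ Mₛ` on every slice. [new here — dictionary; unconditional] -/
theorem innerLimit_dichotomy_of_singularity (hT : 0 < T) (hmax : IsMaximalSmoothSolution 1 0 u p T)
    (hLH : IsLerayHopfOn T 1 0 (u 0) u) (hbdd : ∀ S < T, ∃ N : ℝ, 0 < N ∧ ∀ t ∈ Icc 0 S, ∀ x, ‖u t x‖ ≤ N)
    (haxi : ∀ t, IsAxisymmetric (u t)) (hMₛ : ∀ x, |swirl (u 0) x| ≤ Mₛ) :
    ∃ (tn lamn : ℕ → ℝ) (cn : ℕ → EuclideanSpace ℝ (Fin 3)) (φ : ℕ → ℕ)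
      (W : ℝ → EuclideanSpace ℝ (Fin 3) → EuclideanSpace ℝ (Fin 3)),
      (∀ k, T / 2 ≤ tn k ∧ tn k < T) ∧ (∀ k, 0 < lamn k) ∧ Tendsto lamn atTop (𝓝 0) ∧
      (∀ k, ∀ t ∈ Icc 0 (tn k), ∀ x, lamn k * ‖u t x‖ ≤ 1) ∧ StrictMono φ ∧ IsKNSSBlowupLimit W ∧
      (∀ s < 0, TendstoLocallyUniformly
        (fun k => (lamn (φ k) • stPull (lamn (φ k) ^ 2) (lamn (φ k)) (tn (φ k)) (cn (φ k)) u) s) (W s) atTop) ∧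
      ((∀ s < 0, ∀ y : EuclideanSpace ℝ (Fin 3), W s y = W s 0) ∨
        ((∀ s < 0, IsAxisymmetric (W s)) ∧ ∀ s < 0, ∀ y : EuclideanSpace ℝ (Fin 3), |swirl (W s) y| ≤ Mₛ)) :=
  innerLimit_dichotomy_of_unbounded hT hmax.1 haxi (energyBound_of_lerayHopf hLH) hbdd hMₛ
    (unbounded_of_not_hasSmoothExtensionPast hT hmax.1 hLH hmax.2)

/-- **THE Z1 CENSUS SENTENCE BY DECL, UNCONDITIONAL: at an axisymmetric singularity the inner object is a constant
axial-gauge stream OR a counterexample to (AX-L) with the (I-5) signature.** On K8's standing hypotheses verbatim —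
`IsMaximalSmoothSolution 1 0 u p T⋆` (`T⋆ > 0`), `IsLerayHopfOn T⋆ 1 0 (u 0) u`, bounded on every closed sub-slab,
axisymmetric slices, `|Γ(0, ·)| ≤ Mₛ` — there are gauge N-a zoom data `tₖ ∈ [T⋆/2, T⋆)`, `λₖ > 0`, `λₖ → 0`, centres `cₖ`
(`λₖ‖u‖ ≤ 1` on `[0, tₖ]`) and a subsequence along which `y ↦ λₖ u(tₖ + λₖ² s, cₖ + λₖ y)` converges slice-wise locally
uniformly to a KNSS blow-up limit `W` (`|W| ≤ 1 = sup|W|`, smooth bounded ancient mild) such that EITHER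
(α) `W(s, y) = W(s, 0)` for all `s < 0`, `y`; OR (β) the conjecture `AxisymmetricLiouvilleBoundedSwirl` FAILS (`W` is a
counterexample: axisymmetric slices, `|Γ_W| ≤ Mₛ`, one non-constant slice) AND `W` carries swirl on some slice
(KNSS Thm 5.2) AND `r‖W_pol‖` is unbounded (`violates: V-CR`, KNSS Thm 5.3) AND `Γ_W ∉ L^∞_s L^p` for every
`1 ≤ p < ∞` (LZZ 2017 Thm 1.3) AND `Γ_W` does not decay at radial infinity uniformly (LZZ Rem. 1.4). All kills are
DISCHARGED tree theorems (part XXIV); no conjecture is assumed. [new here — dictionary; unconditional] -/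
theorem innerLimit_alternative_of_singularity (hT : 0 < T) (hmax : IsMaximalSmoothSolution 1 0 u p T)
    (hLH : IsLerayHopfOn T 1 0 (u 0) u) (hbdd : ∀ S < T, ∃ N : ℝ, 0 < N ∧ ∀ t ∈ Icc 0 S, ∀ x, ‖u t x‖ ≤ N)
    (haxi : ∀ t, IsAxisymmetric (u t)) (hMₛ : ∀ x, |swirl (u 0) x| ≤ Mₛ) :
    ∃ (tn lamn : ℕ → ℝ) (cn : ℕ → EuclideanSpace ℝ (Fin 3)) (φ : ℕ → ℕ)
      (W : ℝ → EuclideanSpace ℝ (Fin 3) → EuclideanSpace ℝ (Fin 3)),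
      (∀ k, T / 2 ≤ tn k ∧ tn k < T) ∧ (∀ k, 0 < lamn k) ∧ Tendsto lamn atTop (𝓝 0) ∧
      (∀ k, ∀ t ∈ Icc 0 (tn k), ∀ x, lamn k * ‖u t x‖ ≤ 1) ∧ StrictMono φ ∧ IsKNSSBlowupLimit W ∧
      (∀ s < 0, TendstoLocallyUniformly
        (fun k => (lamn (φ k) • stPull (lamn (φ k) ^ 2) (lamn (φ k)) (tn (φ k)) (cn (φ k)) u) s) (W s) atTop) ∧
      ((∀ s < 0, ∀ y : EuclideanSpace ℝ (Fin 3), W s y = W s 0) ∨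
        (¬ Summit.NavierStokesRegularity.NavierStokesRegularity.AxisymmetricLiouvilleBoundedSwirl ∧
          (∀ s < 0, IsAxisymmetric (W s)) ∧ (∀ s < 0, ∀ y : EuclideanSpace ℝ (Fin 3), |swirl (W s) y| ≤ Mₛ) ∧
          (∃ s < 0, ∃ x : EuclideanSpace ℝ (Fin 3), W s x ≠ W s 0) ∧
          (∃ s < 0, ∃ x : EuclideanSpace ℝ (Fin 3), swirl (W s) x ≠ 0) ∧
          (∀ C : ℝ, ∃ s < 0, ∃ x : EuclideanSpace ℝ (Fin 3), C < cylRadius x * ‖poloidalPart (W s) x‖) ∧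
          (∀ q : ℝ≥0∞, 1 ≤ q → q < ⊤ → ∀ K : ℝ≥0, ∃ s < 0, (K : ℝ≥0∞) < eLpNorm (swirl (W s)) q volume) ∧
          ∃ ε : ℝ, 0 < ε ∧ ∀ R : ℝ, ∃ s < 0, ∃ x : EuclideanSpace ℝ (Fin 3),
            R ≤ cylRadius x ∧ ε < |swirl (W s) x|)) := by
  obtain ⟨tn, lamn, cn, φ, W, htn, hlam, hlam0, hgauge, hφ, hW, hconv, hcase⟩ :=
    innerLimit_dichotomy_of_singularity hT hmax hLH hbdd haxi hMₛ
  refine ⟨tn, lamn, cn, φ, W, htn, hlam, hlam0, hgauge, hφ, hW, hconv, ?_⟩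
  rcases hcase with hconst | ⟨hax, hsw⟩
  · exact Or.inl hconst
  · by_cases hnc : ∃ s < 0, ∃ x : EuclideanSpace ℝ (Fin 3), W s x ≠ W s 0
    · have hsw' : ∃ C : ℝ, ∀ s < 0, ∀ x, |swirl (W s) x| ≤ C := ⟨Mₛ, hsw⟩
      exact Or.inr ⟨not_axisymmetricLiouville_of_innerLimit_typeBeta hW hax hsw' hnc, hax, hsw, hnc,
        typeBeta_exists_swirl_ne_zero hW hax hnc, knssBlowupLimit_VCR_poloidal hW hax hsw',
        fun q hq1 hq K => typeBeta_eLpNorm_swirl_unbounded hW hax hnc hq1 hq K,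
        typeBeta_swirl_not_decay hW hax hnc⟩
    · push Not at hnc
      exact Or.inl hnc

end Alternative

end TypeIIModulationDictionary
end Summit.NavierStokesRegularity.OSWSelfSimilar
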